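import Summits.Ventures.HSemireg.WedgeHankelSubstitutionSingularSplit

/-!
# Venture HSemireg — THE SPECTRUM OF A SINGULAR SUBSTITUTION ON THE CLASSES: `χ(S_c(g)) = X^c·(X − (α+δ)^c)` and `tr S_c(g) = (α+δ)^c` for EVERY singular `g`
# (`αδ = βγ`, every field, every degree), hence on th-7's class space `χ(SbC(g)) = X^n·(X − (α+δ)^n)`, `tr SbC(g) = (α+δ)^n`; `SbC(g) = 0 ↔ g = 0` (`n ≥ 1`);
# the eigenvalues `0` and `(α+δ)^n`, and the MINIMAL POLYNOMIAL: `X·(X − (α+δ)^n)` for `α + δ ≠ 0`, `X²` for a non-zero nilpotent letter map (`n ≥ 1`)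

HONEST FRAMING. Part of the Lean index of the computation cell `pub-hsemireg` (seat p10 gen 20, Sunday typer «UNIFORM-IN-n»).
Finite-dimensional EXTERIOR ALGEBRA + linear algebra ONLY: no variety, no cohomology theory, no sheaf, no Ext group, no semiregularity map;
nothing here says that HC / HC_CM / HC_AV holds; no Literature fact is declared or used.  Custodian versions as in `WedgeHankelSiegelIdeal` (1/3) and `WedgeHankelFrameChange`;
the dictionary (`S_c(g) = Sym^c(g)`; for `g` of rank one with non-zero eigenvalue `t = tr g`, `Sym^c(g)` has the single non-zero eigenvalue `t^c`) is QUOTED, never asserted.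

WHAT IS IN THE TREE.  I9 (`WedgeHankelSubstitutionCharpoly`): `charpoly_sbMat_lower`, `charpoly_sbMat_of_fixed_one` (a fixed node `λ₁ ∈ K`), the swap-conjugation pattern of
`charpoly_sbMat_shear`; I1 `sbMat_comp`, `sbMat_one`, `sbMat_scalar`; I11 `toMatrix_SbC` (`= S_n(g)` in th-7's spike basis), `SbC_isUnit_iff`; I20 `SbC_mul_self_of_det_eq_zero`
(`SbC(g)² = (α+δ)^n·SbC(g)`), `SbC_mul_self_eq_zero_of_nilpotent`; I21 `SbC_apply_of_mem_range`.  Those files leave the trace `(α+δ)^n` and the minimal polynomial un-typed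
(I20/I21 «NOT typed here»).  THIS FILE (namespace `Summit.Ventures.HSemireg.Wedge.HankelFrameChange` continued; imports I21):
* §219 **`charpoly_sbMat_of_det_eq_zero`: `χ(S_c(α β γ δ)) = X^c · (X − C((α+δ)^c))` whenever `αδ = βγ`** (three cases: `α ≠ 0` — the image letter `β/α` is a fixed node with
  eigenvalues `α + δ`, `0`; `α = β = 0` — a lower substitution; `α = γ = 0` — the swap-conjugate of the lower substitution `(δ, 0, β, 0)`), and **`trace_sbMat_of_det_eq_zero`:
  `tr S_c(g) = (α+δ)^c`** (the second coefficient of the characteristic polynomial).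
* §220 on th-7's class space: **`charpoly_SbC_of_det_eq_zero`** (`X^n·(X − C((α+δ)^n))`), **`trace_SbC_of_det_eq_zero`** (`(α+δ)^n`); `Sb_w_spike_zero` (`Sb g (E_0) = w_n(α^{n−j}β^j)`),
  **`SbC_eq_zero_iff`** (`n ≥ 1`: `SbC(g) = 0 ↔ α = β = γ = δ = 0`), `SbC_ne_zero_of_trace_ne_zero`.
* §221 EIGENVALUES AND MINIMAL POLYNOMIAL (`n ≥ 1`, `αδ = βγ`): **`hasEigenvalue_SbC_zero`**, **`hasEigenvalue_SbC_trace_pow`** (`(α+δ)^n`, for `α + δ ≠ 0`),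
  `aeval_SbC_X_mul_X_sub_C` (`SbC(g)·(SbC(g) − (α+δ)^n) = 0`), **`minpoly_SbC_of_det_eq_zero`: `minpoly = X·(X − C((α+δ)^n))` for `α + δ ≠ 0`** — the substitution is
  DIAGONALIZABLE on the classes with spectrum `{0^{(n)}, (α+δ)^n}` (I21's splitting `ker ⊕ range`) — and **`minpoly_SbC_of_nilpotent`: `minpoly = X²`** for `α + δ = 0`, `g ≠ 0`
  (I20: square-zero, not zero).
NOT typed here: the Jordan type of a singular `g` beyond the minimal polynomial (it is determined: `n` blocks, one of size `2` in the nilpotent case); anything Ext-side.  New names only.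
-/

open Module

namespace Summit.Ventures.HSemireg.Wedge.HankelFrameChange

open Summit.Ventures.HSemireg.Wedge Summit.Ventures.HSemireg.Wedge.Kunneth Summit.Ventures.HSemireg.Wedge.Hankel
  Summit.Ventures.HSemireg.Wedge.BasisFree Summit.Ventures.HSemireg.Wedge.HankelSiegel Summit.Ventures.HSemireg.Wedge.HankelSiegelIdeal
  Summit.Ventures.HSemireg.Wedge.KunnethKernel Summit.Ventures.HSemireg.Wedge.HankelRankOne Summit.Ventures.HSemireg.Wedge.KernelDuality

variable (K : Type*) [Field K] {n : ℕ}

/-! ## §219. The characteristic polynomial and the trace of `S_c(g)` for a singular `g` -/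

/-- `Π_{l ≤ c} (X − C(t^{c−l}·0^l)) = X^c · (X − C(t^c))` (only `l = 0` carries a non-zero root). -/
private lemma prod_X_sub_C_pow_mul_zero_pow (t : K) (c : ℕ) :
    ∏ l : Fin (c + 1), (Polynomial.X - Polynomial.C (t ^ (c - (l : ℕ)) * (0 : K) ^ (l : ℕ))) = Polynomial.X ^ c * (Polynomial.X - Polynomial.C (t ^ c)) := by
  rw [Fin.prod_univ_succ]
  have e : ∀ l : Fin c, (Polynomial.X - Polynomial.C (t ^ (c - (l.succ : ℕ)) * (0 : K) ^ (l.succ : ℕ))) = Polynomial.X := fun l => by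
    rw [Fin.val_succ, zero_pow (Nat.succ_ne_zero _), mul_zero, map_zero, sub_zero]
  simp only [Fin.val_zero, Nat.sub_zero, pow_zero, mul_one, e, Finset.prod_const, Finset.card_univ, Fintype.card_fin]
  rw [mul_comm]

/-- `Π_{l ≤ c} (X − C(0^{c−l}·t^l)) = X^c · (X − C(t^c))` (only `l = c` carries a non-zero root). -/
private lemma prod_X_sub_C_zero_pow_mul_pow (t : K) (c : ℕ) :
    ∏ l : Fin (c + 1), (Polynomial.X - Polynomial.C ((0 : K) ^ (c - (l : ℕ)) * t ^ (l : ℕ))) = Polynomial.X ^ c * (Polynomial.X - Polynomial.C (t ^ c)) := by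
  rw [Fin.prod_univ_castSucc]
  have e : ∀ l : Fin c, (Polynomial.X - Polynomial.C ((0 : K) ^ (c - (Fin.castSucc l : ℕ)) * t ^ (Fin.castSucc l : ℕ))) = Polynomial.X := fun l => by
    rw [Fin.val_castSucc, zero_pow (by have := l.2; omega), zero_mul, map_zero, sub_zero]
  simp only [e, Finset.prod_const, Finset.card_univ, Fintype.card_fin, Fin.val_last, Nat.sub_self, pow_zero, one_mul]

/-- **THE CHARACTERISTIC POLYNOMIAL OF THE MOMENT MATRIX OF A SINGULAR SUBSTITUTION: `χ(S_c(α β γ δ)) = X^c · (X − C((α+δ)^c))` whenever `αδ = βγ`** (every field, every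
degree `c`).  Cases: `α ≠ 0` — the image letter `λ₁ = β/α` is a fixed node, with `α + λ₁γ = α + δ` and `δ − λ₁γ = 0` (I9 `charpoly_sbMat_of_fixed_one`); `α = β = 0` — a lower
substitution (I9 `charpoly_sbMat_lower`); `α = γ = 0` — `S_c(0 β 0 δ) = W·S_c(δ 0 β 0)·W` with `W = S_c(0 1 1 0)`, `W² = 1` (I1 `sbMat_comp`) and `charpoly_mul_comm`. -/
theorem charpoly_sbMat_of_det_eq_zero {α β γ δ : K} (hdet : α * δ - β * γ = 0) (c : ℕ) :
    (sbMat K α β γ δ c (c + 1)).charpoly = Polynomial.X ^ c * (Polynomial.X - Polynomial.C ((α + δ) ^ c)) := by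
  by_cases hα : α = 0
  · subst hα
    have hβγ : β * γ = 0 := by linear_combination -hdet
    by_cases hβ : β = 0
    · subst hβ
      rw [charpoly_sbMat_lower, zero_add]
      exact prod_X_sub_C_zero_pow_mul_pow K δ c
    · have hγ : γ = 0 := (mul_eq_zero.mp hβγ).resolve_left hβ
      subst hγ
      -- `(0,β,0,δ) = w·(δ,0,β,0)·w` as substitutions, `w = (0,1,1,0)`, `w·w = 1`
      have e1 : sbMat K 0 β 0 δ c (c + 1) = sbMat K 0 1 1 0 c (c + 1) * (sbMat K δ 0 β 0 c (c + 1) * sbMat K 0 1 1 0 c (c + 1)) := by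
        rw [← sbMat_comp, ← sbMat_comp]; congr 1 <;> ring
      have e2 : sbMat K 0 1 1 0 c (c + 1) * sbMat K 0 1 1 0 c (c + 1) = 1 := by
        rw [← sbMat_comp, ← sbMat_one K c]; congr 1 <;> ring
      rw [e1, Matrix.charpoly_mul_comm, mul_assoc, e2, mul_one, charpoly_sbMat_lower, zero_add]
      exact prod_X_sub_C_pow_mul_zero_pow K δ c
  · -- the image letter `β/α` is a fixed node
    have hδ : δ = β * γ / α := by
      field_simp
      linear_combination hdet
    subst hδ
    have e₁ : β + β / α * (β * γ / α) = β / α * (α + β / α * γ) := by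
      field_simp
    rw [charpoly_sbMat_of_fixed_one K e₁ c]
    have h1 : α + β / α * γ = α + β * γ / α := by ring
    have h2 : β * γ / α - β / α * γ = 0 := by ring
    rw [h1, h2]
    exact prod_X_sub_C_pow_mul_zero_pow K (α + β * γ / α) c

/-- **THE TRACE: `tr S_c(g) = (α+δ)^c` for every singular `g`** (`αδ = βγ`; the `X^{c}`-coefficient of §219's characteristic polynomial). -/
theorem trace_sbMat_of_det_eq_zero {α β γ δ : K} (hdet : α * δ - β * γ = 0) (c : ℕ) :
    (sbMat K α β γ δ c (c + 1)).trace = (α + δ) ^ c := by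
  rw [Matrix.trace_eq_neg_charpoly_coeff, charpoly_sbMat_of_det_eq_zero K hdet, Fintype.card_fin, Nat.add_sub_cancel, mul_sub, ← pow_succ,
    Polynomial.coeff_sub, Polynomial.coeff_X_pow, if_neg (Nat.succ_ne_self c).symm, Polynomial.coeff_mul_C, Polynomial.coeff_X_pow, if_pos rfl, one_mul, zero_sub, neg_neg]

/-! ## §220. On th-7's class space -/

/-- **`χ(SbC(g)) = X^n · (X − C((α+δ)^n))` on the class space, for `αδ = βγ`** (I11 `toMatrix_SbC` + §219; basis-free). -/
theorem charpoly_SbC_of_det_eq_zero {α β γ δ : K} (hdet : α * δ - β * γ = 0) :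
    (SbC K α β γ δ (n := n)).charpoly = Polynomial.X ^ n * (Polynomial.X - Polynomial.C ((α + δ) ^ n)) := by
  rw [← LinearMap.charpoly_toMatrix _ (spikeBasis K n), toMatrix_SbC, charpoly_sbMat_of_det_eq_zero K hdet]

/-- **`tr SbC(g) = (α+δ)^n` on the class space, for `αδ = βγ`** — with I20/I21: `SbC(g) = (α+δ)^n ·` (a rank-one projection) when `α + δ ≠ 0`. -/
theorem trace_SbC_of_det_eq_zero {α β γ δ : K} (hdet : α * δ - β * γ = 0) :
    LinearMap.trace K _ (SbC K α β γ δ (n := n)) = (α + δ) ^ n := by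
  rw [LinearMap.trace_eq_matrix_trace K (spikeBasis K n), toMatrix_SbC, trace_sbMat_of_det_eq_zero K hdet]

/-- `SbC(g) ≠ 0` as soon as `α + δ ≠ 0` (`αδ = βγ`): its trace is `(α+δ)^n`. -/
theorem SbC_ne_zero_of_trace_ne_zero {α β γ δ : K} (hdet : α * δ - β * γ = 0) (htr : α + δ ≠ 0) : SbC K α β γ δ (n := n) ≠ 0 := by
  intro h
  have e := trace_SbC_of_det_eq_zero K (n := n) hdet
  rw [h, map_zero] at e
  exact pow_ne_zero n htr e.symm

/-- **`Sb g (E_0) = w_n((α^{n−j} β^j)_j)`**: the image of th-7's pure class `E_0 = Π_a x_a` (I4 `Sb_w_pure` at the node `λ = 0`). -/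
theorem Sb_w_spike_zero (α β γ δ : K) :
    Sb K α β γ δ (w K n n (fun j => if j = 0 then (1 : K) else 0)) = w K n n (fun j => α ^ (n - j) * β ^ j) := by
  have e : (fun j : ℕ => if j = 0 then (1 : K) else 0) = fun j => (0 : K) ^ j := funext fun j => by
    rcases j with _ | j
    · rw [if_pos rfl, pow_zero]
    · rw [if_neg (Nat.succ_ne_zero j), zero_pow (Nat.succ_ne_zero j)]
  rw [e, Sb_w_pure K α β γ δ 0 le_rfl]
  exact w_eq_of_agree K n fun j _ => by rw [zero_mul, add_zero, zero_mul, add_zero]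

/-- **`SbC(g) = 0` ON TH-7's CLASSES IFF `g = 0`** (`n ≥ 1`; for `n = 0` the class space is `K·1` and every `SbC` is the identity): the images of `E_0` and of `E_n` are
`w_n(α^{n−j}β^j)` and, once `α = β = 0`, `w_n(γ^{n−j}δ^j)`. -/
theorem SbC_eq_zero_iff (hn : 1 ≤ n) (α β γ δ : K) : SbC K α β γ δ (n := n) = 0 ↔ α = 0 ∧ β = 0 ∧ γ = 0 ∧ δ = 0 := by
  constructor
  · intro h
    have hE : ∀ q : ℕ → K, Sb K α β γ δ (w K n n q) = 0 := fun q => by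
      have e := congrArg Subtype.val (LinearMap.congr_fun h ⟨w K n n q, w_mem_spikeSpan K q⟩)
      rwa [SbC_apply_coe, LinearMap.zero_apply] at e
    have h0 := hE (fun j => if j = 0 then (1 : K) else 0)
    rw [Sb_w_spike_zero, ← w_zero K (n := n) n, w_eq_w_iff] at h0
    have hα : α = 0 := by
      have e := h0 0 (Nat.zero_le n)
      rw [Nat.sub_zero, pow_zero, mul_one] at e
      exact (pow_eq_zero_iff (by omega)).mp e
    have hβ : β = 0 := by
      have e := h0 n le_rfl
      rw [Nat.sub_self, pow_zero, one_mul] at e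
      exact (pow_eq_zero_iff (by omega)).mp e
    subst hα hβ
    have h1 := hE (fun j => if j = n then (1 : K) else 0)
    rw [Sb_w_of_alpha_beta_zero, if_pos rfl, ← w_zero K (n := n) n, w_eq_w_iff] at h1
    have hγ : γ = 0 := by
      have e := h1 0 (Nat.zero_le n)
      rw [Nat.sub_zero, pow_zero, one_mul, mul_one] at e
      exact (pow_eq_zero_iff (by omega)).mp e
    have hδ : δ = 0 := by
      have e := h1 n le_rfl
      rw [Nat.sub_self, pow_zero, one_mul, one_mul] at e
      exact (pow_eq_zero_iff (by omega)).mp e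
    exact ⟨rfl, rfl, hγ, hδ⟩
  · rintro ⟨rfl, rfl, rfl, rfl⟩
    apply (LinearMap.toMatrix (spikeBasis K n) (spikeBasis K n)).injective
    rw [toMatrix_SbC, map_zero, sbMat_scalar, zero_pow (by omega), zero_smul]

/-! ## §221. Eigenvalues and the minimal polynomial of a singular substitution on the classes -/

/-- **`0` IS AN EIGENVALUE of a singular substitution on the classes** (`n ≥ 1`, `αδ = βγ`: `SbC(g)` is not a unit, I11 `SbC_isUnit_iff`). -/
theorem hasEigenvalue_SbC_zero (hn : 1 ≤ n) {α β γ δ : K} (hdet : α * δ - β * γ = 0) : Module.End.HasEigenvalue (SbC K α β γ δ (n := n)) 0 := by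
  rw [Module.End.hasEigenvalue_iff, Module.End.eigenspace_zero, Ne, ← LinearMap.isUnit_iff_ker_eq_bot, SbC_isUnit_iff K hn]
  exact fun h => h hdet

/-- **`(α+δ)^n` IS AN EIGENVALUE** for `αδ = βγ`, `α + δ ≠ 0` (the image is a non-zero eigen-space, I21 `SbC_apply_of_mem_range` + §220). -/
theorem hasEigenvalue_SbC_trace_pow {α β γ δ : K} (hdet : α * δ - β * γ = 0) (htr : α + δ ≠ 0) :
    Module.End.HasEigenvalue (SbC K α β γ δ (n := n)) ((α + δ) ^ n) := by
  rw [Module.End.hasEigenvalue_iff]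
  intro h
  apply SbC_ne_zero_of_trace_ne_zero K (n := n) hdet htr
  rw [← LinearMap.range_eq_bot, Submodule.eq_bot_iff]
  intro f hf
  have hf' : f ∈ Module.End.eigenspace (SbC K α β γ δ (n := n)) ((α + δ) ^ n) := Module.End.mem_eigenspace_iff.mpr (SbC_apply_of_mem_range K hdet hf)
  rw [h] at hf'
  exact (Submodule.mem_bot K).mp hf'

/-- `SbC(g)` is annihilated by `X·(X − C((α+δ)^n))` (`αδ = βγ`; I20 `SbC(g)² = (α+δ)^n·SbC(g)`). -/
theorem aeval_SbC_X_mul_X_sub_C {α β γ δ : K} (hdet : α * δ - β * γ = 0) :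
    Polynomial.aeval (SbC K α β γ δ (n := n)) (Polynomial.X * (Polynomial.X - Polynomial.C ((α + δ) ^ n))) = 0 := by
  rw [show (Polynomial.X : Polynomial K) * (Polynomial.X - Polynomial.C ((α + δ) ^ n)) = Polynomial.X ^ 2 - Polynomial.C ((α + δ) ^ n) * Polynomial.X by ring,
    map_sub, map_mul, map_pow, Polynomial.aeval_X, Polynomial.aeval_C, Algebra.algebraMap_eq_smul_one, smul_mul_assoc, one_mul, pow_two,
    SbC_mul_self_of_det_eq_zero K hdet, sub_self]

/-- **THE MINIMAL POLYNOMIAL OF A SINGULAR, NON-NILPOTENT SUBSTITUTION ON THE CLASSES: `minpoly = X · (X − C((α+δ)^n))`** (`n ≥ 1`, `αδ = βγ`, `α + δ ≠ 0`) — two DISTINCT simple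
roots: the substitution is diagonalizable on th-7's class space with spectrum `0` (multiplicity `n`, §220's `χ`) and `(α+δ)^n` (simple); cf. I21 `isCompl_ker_range_SbC_of_det_eq_zero`. -/
theorem minpoly_SbC_of_det_eq_zero (hn : 1 ≤ n) {α β γ δ : K} (hdet : α * δ - β * γ = 0) (htr : α + δ ≠ 0) :
    minpoly K (SbC K α β γ δ (n := n)) = Polynomial.X * (Polynomial.X - Polynomial.C ((α + δ) ^ n)) := by
  set T := SbC K α β γ δ (n := n)
  have hT : IsIntegral K T := Algebra.IsIntegral.isIntegral T
  have ht : (α + δ) ^ n ≠ 0 := pow_ne_zero n htr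
  -- `minpoly ∣ X (X − C t)`
  have h1 : minpoly K T ∣ Polynomial.X * (Polynomial.X - Polynomial.C ((α + δ) ^ n)) := minpoly.dvd K T (aeval_SbC_X_mul_X_sub_C K hdet)
  -- both roots occur
  have r0 : (minpoly K T).IsRoot 0 := Module.End.isRoot_of_hasEigenvalue (hasEigenvalue_SbC_zero K hn hdet)
  have r1 : (minpoly K T).IsRoot ((α + δ) ^ n) := Module.End.isRoot_of_hasEigenvalue (hasEigenvalue_SbC_trace_pow K hdet htr)
  have d0 : Polynomial.X ∣ minpoly K T := by simpa only [map_zero, sub_zero] using Polynomial.dvd_iff_isRoot.mpr r0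
  have d1 : Polynomial.X - Polynomial.C ((α + δ) ^ n) ∣ minpoly K T := Polynomial.dvd_iff_isRoot.mpr r1
  have hcop : IsCoprime (Polynomial.X : Polynomial K) (Polynomial.X - Polynomial.C ((α + δ) ^ n)) := by
    have h := Polynomial.isCoprime_X_sub_C_of_isUnit_sub (R := K) (a := 0) (b := (α + δ) ^ n) (by rw [zero_sub, isUnit_iff_ne_zero, neg_ne_zero]; exact ht)
    simpa only [map_zero, sub_zero] using h
  have h2 : Polynomial.X * (Polynomial.X - Polynomial.C ((α + δ) ^ n)) ∣ minpoly K T := hcop.mul_dvd d0 d1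
  exact Polynomial.eq_of_monic_of_associated (minpoly.monic hT) (Polynomial.monic_X.mul (Polynomial.monic_X_sub_C _)) (associated_of_dvd_dvd h1 h2)

/-- **THE MINIMAL POLYNOMIAL OF A NON-ZERO NILPOTENT LETTER MAP ON THE CLASSES: `minpoly = X²`** (`n ≥ 1`, `αδ = βγ`, `α + δ = 0`, `g ≠ 0`): square-zero (I20) but not zero (§220). -/
theorem minpoly_SbC_of_nilpotent (hn : 1 ≤ n) {α β γ δ : K} (hdet : α * δ - β * γ = 0) (htr : α + δ = 0) (hg : ¬ (α = 0 ∧ β = 0 ∧ γ = 0 ∧ δ = 0)) :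
    minpoly K (SbC K α β γ δ (n := n)) = Polynomial.X ^ 2 := by
  set T := SbC K α β γ δ (n := n)
  have hT : IsIntegral K T := Algebra.IsIntegral.isIntegral T
  have h1 : minpoly K T ∣ Polynomial.X ^ 2 := minpoly.dvd K T (by rw [map_pow, Polynomial.aeval_X, pow_two, SbC_mul_self_eq_zero_of_nilpotent K hdet htr hn])
  obtain ⟨i, hi, hassoc⟩ := (dvd_prime_pow Polynomial.prime_X 2).mp h1
  have heq : minpoly K T = Polynomial.X ^ i := Polynomial.eq_of_monic_of_associated (minpoly.monic hT) (Polynomial.monic_X.pow i) hassoc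
  haveI : Nontrivial (spikeSpan K n) := Module.nontrivial_of_finrank_pos (R := K) (by rw [finrank_eq_card_basis (spikeBasis K n), Fintype.card_fin]; omega)
  interval_cases i
  · exact absurd (by rw [heq, pow_zero]) (minpoly.ne_one K T)
  · exfalso
    have e := minpoly.aeval K T
    rw [heq, pow_one, Polynomial.aeval_X] at e
    exact hg ((SbC_eq_zero_iff K hn α β γ δ).mp e)
  · exact heq

end Summit.Ventures.HSemireg.Wedge.HankelFrameChange
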